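import Summits.QuantumFields.YangMills.Theorems.LuscherReductionOneSiteLevelsKacSpan

/-!
# INNER, flat lane (layer III): the gradient of Lüscher's potential and the regularity of `H₀F`

Support module of crux `OneSiteLevels` (route `LuscherReduction`, item stmt-QuantumFields-20007), FLAT lane of the
registered v12 stub `stub_flatKacAL1` (STUB-PLAN rev 3 rows III.5/III.9, bookkeeping: the cross term needs
`h = H₀F = Σ c_j (E_j − V) f_j ∈ C¹` with `∇h ∈ L¹ ∩ L²`, hence a polynomial bound on `∇V`).

* §1 `luscherPotential_contDiff`: `V ∈ C^∞` (`4V = ‖x‖⁴ − Σ_{ij}(x_i·x_j)²`, a polynomial in the coordinates);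
  `abs_luscherPotential_add_sub_le`: `|V(y+z) − V(y)| ≤ (5/2)(2‖y‖+‖z‖)‖z‖(2‖y‖²+2‖y‖‖z‖+‖z‖²)`;
  `norm_fderiv_luscherPotential_le`: `‖DV(y)‖ ≤ 10 (1 + ‖y‖)³` (Mathlib `HasFDerivAt.le_of_lip'`).
* §2 `integrable_of_le_pow_mul_exp`: continuous `g` with `|g| ≤ A (1+‖x‖)^k e^{−‖x‖}` is integrable (domination by
  `(1+‖x‖)^{−10} ∈ L¹(ℝ⁹)`).
* §3 for an AL1 eigen-span: `h = eigSpanH0 f c` is `C¹`, with `|∂_p h| ≤ A (Σ|c_j|)(1+‖x‖)⁴ e^{−‖x‖}`, `h, ∂_p h ∈ L¹`,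
  `‖Dh‖ ∈ L¹`, and `Σ_p ∫ (∂_p h)² ≤ K' Σ c_j²`.

Real analysis only ([folklore]); NOT the stub; femto rung R2b1; NOT a claim about the gap.
-/

set_option autoImplicit false

noncomputable section

open MeasureTheory Filter Topology Real
open Literature.Analysis.OperatorTheory.YMMatrixModel

namespace Summit.QuantumFields.YangMills.Theorems.FemtoTransferGap

/-! ### §1. Smoothness and the gradient of the potential -/

section Potential

/-- The coordinates of `ZM` are smooth. [folklore] -/
theorem contDiff_coordZM (p : Fin 3 × Fin 3) {n : ℕ∞} : ContDiff ℝ n fun x : ZM => x p :=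
  (PiLp.proj 2 (𝕜 := ℝ) (fun _ : Fin 3 × Fin 3 => ℝ) p).contDiff

/-- The Gram entries `x ↦ x_i · x_j` are smooth. [folklore] -/
theorem contDiff_gram (i j : Fin 3) {n : ℕ∞} : ContDiff ℝ n fun x : ZM => colourVec x i ⬝ᵥ colourVec x j := by
  simp only [dotProduct, colourVec]
  exact ContDiff.sum fun a _ => (contDiff_coordZM (i, a)).mul (contDiff_coordZM (j, a))

/-- **`V ∈ C^n`** for every `n` (`4V = ‖x‖⁴ − Σ_{ij}(x_i·x_j)²`). [folklore] -/
theorem luscherPotential_contDiff {n : ℕ∞} : ContDiff ℝ n luscherPotential := by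
  have e : luscherPotential = fun x : ZM => (1 / 4 : ℝ) * ((‖x‖ ^ 2) ^ 2 - ∑ i, ∑ j, (colourVec x i ⬝ᵥ colourVec x j) ^ 2) := by
    funext x
    have h := four_mul_luscherPotential x
    have : ‖x‖ ^ 4 = (‖x‖ ^ 2) ^ 2 := by ring
    rw [this] at h
    linarith
  rw [e]
  refine contDiff_const.mul (((contDiff_norm_sq ℝ).pow 2).sub ?_)
  exact ContDiff.sum fun i _ => ContDiff.sum fun j _ => (contDiff_gram i j).pow 2

/-- `|x_i · z_j| ≤ ‖x‖ ‖z‖`. [folklore] -/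
theorem abs_colourDot_le (x z : ZM) (i j : Fin 3) : |colourVec x i ⬝ᵥ colourVec z j| ≤ ‖x‖ * ‖z‖ := by
  have hcs := Finset.sum_mul_sq_le_sq_mul_sq Finset.univ (colourVec x i) (colourVec z j)
  -- `(x_i·z_j)² ≤ |x_i|²|z_j|² ≤ ‖x‖²‖z‖²`
  have hcsq : ∀ (w : ZM) (k : Fin 3), (∑ a, colourVec w k a ^ 2) = csq k w := fun w k => by
    rw [csq_eq_sum]; rfl
  have h1 : (∑ a, colourVec x i a ^ 2) ≤ ‖x‖ ^ 2 := by
    rw [norm_sq_eq_sum_csq, hcsq]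
    exact Finset.single_le_sum (fun k _ => csq_nonneg k x) (Finset.mem_univ i)
  have h2 : (∑ a, colourVec z j a ^ 2) ≤ ‖z‖ ^ 2 := by
    rw [norm_sq_eq_sum_csq, hcsq]
    exact Finset.single_le_sum (fun k _ => csq_nonneg k z) (Finset.mem_univ j)
  have hsq : (colourVec x i ⬝ᵥ colourVec z j) ^ 2 ≤ (‖x‖ * ‖z‖) ^ 2 := by
    rw [dotProduct, mul_pow]
    exact hcs.trans (mul_le_mul h1 h2 (Finset.sum_nonneg fun a _ => sq_nonneg _) (sq_nonneg _))
  exact abs_le_of_sq_le_sq hsq (by positivity)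

/-- **Increment bound for the potential**:
`|V(y+z) − V(y)| ≤ (5/2)·(2‖y‖‖z‖ + ‖z‖²)·(2‖y‖² + 2‖y‖‖z‖ + ‖z‖²)`. [folklore] -/
theorem abs_luscherPotential_add_sub_le (y z : ZM) :
    |luscherPotential (y + z) - luscherPotential y| ≤
      (5 / 2 : ℝ) * ((2 * ‖y‖ * ‖z‖ + ‖z‖ ^ 2) * (2 * ‖y‖ ^ 2 + 2 * ‖y‖ * ‖z‖ + ‖z‖ ^ 2)) := by
  have h1 := four_mul_luscherPotential (y + z)
  have h2 := four_mul_luscherPotential y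
  have hy := norm_nonneg y
  have hz := norm_nonneg z
  -- norm part
  have hn : ‖y + z‖ ^ 2 = ‖y‖ ^ 2 + 2 * inner ℝ y z + ‖z‖ ^ 2 := norm_add_sq_real y z
  have hin : |inner ℝ y z| ≤ ‖y‖ * ‖z‖ := abs_real_inner_le_norm y z
  have hN : |‖y + z‖ ^ 4 - ‖y‖ ^ 4| ≤ (2 * ‖y‖ * ‖z‖ + ‖z‖ ^ 2) * (2 * ‖y‖ ^ 2 + 2 * ‖y‖ * ‖z‖ + ‖z‖ ^ 2) := by
    have e : ‖y + z‖ ^ 4 - ‖y‖ ^ 4 = (2 * inner ℝ y z + ‖z‖ ^ 2) * (2 * ‖y‖ ^ 2 + 2 * inner ℝ y z + ‖z‖ ^ 2) := by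
      have : ‖y + z‖ ^ 4 = (‖y + z‖ ^ 2) ^ 2 := by ring
      rw [this, hn]; ring
    rw [e, abs_mul]
    have hI : |2 * inner ℝ y z| ≤ 2 * ‖y‖ * ‖z‖ := by rw [abs_mul, abs_two]; nlinarith
    have hz2 : |‖z‖ ^ 2| = ‖z‖ ^ 2 := abs_of_nonneg (sq_nonneg ‖z‖)
    have hy2 : |2 * ‖y‖ ^ 2| = 2 * ‖y‖ ^ 2 := abs_of_nonneg (by positivity)
    have hb1 : |2 * inner ℝ y z + ‖z‖ ^ 2| ≤ 2 * ‖y‖ * ‖z‖ + ‖z‖ ^ 2 := by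
      have := abs_add_le (2 * inner ℝ y z) (‖z‖ ^ 2); linarith
    have hb2 : |2 * ‖y‖ ^ 2 + 2 * inner ℝ y z + ‖z‖ ^ 2| ≤ 2 * ‖y‖ ^ 2 + 2 * ‖y‖ * ‖z‖ + ‖z‖ ^ 2 := by
      have h1 := abs_add_le (2 * ‖y‖ ^ 2 + 2 * inner ℝ y z) (‖z‖ ^ 2)
      have h2 := abs_add_le (2 * ‖y‖ ^ 2) (2 * inner ℝ y z)
      linarith
    exact mul_le_mul hb1 hb2 (abs_nonneg _) (by positivity)
  -- Gram part, per pair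
  have hG : ∀ i j, |(colourVec (y + z) i ⬝ᵥ colourVec (y + z) j) ^ 2 - (colourVec y i ⬝ᵥ colourVec y j) ^ 2| ≤
      (2 * ‖y‖ * ‖z‖ + ‖z‖ ^ 2) * (2 * ‖y‖ ^ 2 + 2 * ‖y‖ * ‖z‖ + ‖z‖ ^ 2) := by
    intro i j
    rw [gram_add]
    set a := colourVec y i ⬝ᵥ colourVec y j with ha_def
    set b := colourVec y i ⬝ᵥ colourVec z j + colourVec z i ⬝ᵥ colourVec y j with hb_def
    set c := colourVec z i ⬝ᵥ colourVec z j with hc_def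
    have ha : |a| ≤ ‖y‖ * ‖y‖ := abs_colourDot_le y y i j
    have hb : |b| ≤ 2 * ‖y‖ * ‖z‖ := by
      have h1 := abs_add_le (colourVec y i ⬝ᵥ colourVec z j) (colourVec z i ⬝ᵥ colourVec y j)
      have h2 := abs_colourDot_le y z i j; have h3 := abs_colourDot_le z y i j
      simp only [hb_def] at *
      nlinarith
    have hc : |c| ≤ ‖z‖ * ‖z‖ := abs_colourDot_le z z i j
    have e : (a + b + c) ^ 2 - a ^ 2 = (b + c) * (2 * a + b + c) := by ring
    rw [e, abs_mul]
    have hb1 : |b + c| ≤ 2 * ‖y‖ * ‖z‖ + ‖z‖ ^ 2 := by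
      have := abs_add_le b c; nlinarith
    have hb2 : |2 * a + b + c| ≤ 2 * ‖y‖ ^ 2 + 2 * ‖y‖ * ‖z‖ + ‖z‖ ^ 2 := by
      have h1 := abs_add_le (2 * a + b) c
      have h2 := abs_add_le (2 * a) b
      have h3 : |2 * a| = 2 * |a| := by rw [abs_mul, abs_two]
      nlinarith
    exact mul_le_mul hb1 hb2 (abs_nonneg _) (by positivity)
  -- sum over the nine pairs
  have hsum : |(∑ i, ∑ j, (colourVec (y + z) i ⬝ᵥ colourVec (y + z) j) ^ 2) - ∑ i, ∑ j, (colourVec y i ⬝ᵥ colourVec y j) ^ 2| ≤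
      9 * ((2 * ‖y‖ * ‖z‖ + ‖z‖ ^ 2) * (2 * ‖y‖ ^ 2 + 2 * ‖y‖ * ‖z‖ + ‖z‖ ^ 2)) := by
    rw [← Finset.sum_sub_distrib]
    refine (Finset.abs_sum_le_sum_abs _ _).trans ?_
    have h9 : ∑ _i : Fin 3, ∑ _j : Fin 3, ((2 * ‖y‖ * ‖z‖ + ‖z‖ ^ 2) * (2 * ‖y‖ ^ 2 + 2 * ‖y‖ * ‖z‖ + ‖z‖ ^ 2)) =
        9 * ((2 * ‖y‖ * ‖z‖ + ‖z‖ ^ 2) * (2 * ‖y‖ ^ 2 + 2 * ‖y‖ * ‖z‖ + ‖z‖ ^ 2)) := by simp; ring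
    rw [← h9]
    refine Finset.sum_le_sum fun i _ => ?_
    rw [← Finset.sum_sub_distrib]
    exact (Finset.abs_sum_le_sum_abs _ _).trans (Finset.sum_le_sum fun j _ => hG i j)
  -- combine: `4(V(y+z) − V(y)) = (‖y+z‖⁴ − ‖y‖⁴) − (ΣΣ… − ΣΣ…)`
  have e4 : 4 * (luscherPotential (y + z) - luscherPotential y) =
      (‖y + z‖ ^ 4 - ‖y‖ ^ 4) - ((∑ i, ∑ j, (colourVec (y + z) i ⬝ᵥ colourVec (y + z) j) ^ 2) -
        ∑ i, ∑ j, (colourVec y i ⬝ᵥ colourVec y j) ^ 2) := by linarith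
  have h4 : |4 * (luscherPotential (y + z) - luscherPotential y)| ≤
      10 * ((2 * ‖y‖ * ‖z‖ + ‖z‖ ^ 2) * (2 * ‖y‖ ^ 2 + 2 * ‖y‖ * ‖z‖ + ‖z‖ ^ 2)) := by
    rw [e4]; refine (abs_sub _ _).trans ?_; linarith
  rw [abs_mul, abs_of_pos (by norm_num : (0:ℝ) < 4)] at h4
  linarith

/-- **Polynomial bound on the gradient of the potential**: `‖DV(y)‖ ≤ 10 (1 + ‖y‖)³`. [folklore] -/
theorem norm_fderiv_luscherPotential_le (y : ZM) : ‖fderiv ℝ luscherPotential y‖ ≤ 10 * (1 + ‖y‖) ^ 3 := by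
  have hd : HasFDerivAt luscherPotential (fderiv ℝ luscherPotential y) y :=
    ((luscherPotential_contDiff (n := 1)).differentiable one_ne_zero y).hasFDerivAt
  refine hd.le_of_lip' (by positivity) ?_
  -- on the unit ball around `y`: `|V x − V y| ≤ 10(1+‖y‖)³ ‖x − y‖`
  have hball : ∀ᶠ x in 𝓝 y, ‖x - y‖ ≤ 1 := by
    have : Metric.closedBall y 1 ∈ 𝓝 y := Metric.closedBall_mem_nhds y one_pos
    filter_upwards [this] with x hx
    rwa [Metric.mem_closedBall, dist_eq_norm] at hx
  filter_upwards [hball] with x hx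
  have h := abs_luscherPotential_add_sub_le y (x - y)
  rw [add_sub_cancel] at h
  rw [Real.norm_eq_abs]
  refine h.trans ?_
  set s := ‖y‖ with hs
  set w := ‖x - y‖ with hw
  have hs0 : 0 ≤ s := norm_nonneg _
  have hw0 : 0 ≤ w := norm_nonneg _
  -- `(2sw + w²)(2s² + 2sw + w²) ≤ w (2s+1)(2s²+2s+1) ≤ 4 w (1+s)³` for `w ≤ 1`
  have h1 : 2 * s * w + w ^ 2 ≤ w * (2 * s + 1) := by nlinarith
  have h2 : 2 * s ^ 2 + 2 * s * w + w ^ 2 ≤ 2 * s ^ 2 + 2 * s + 1 := by nlinarith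
  have h3 : (2 * s + 1) * (2 * s ^ 2 + 2 * s + 1) ≤ 4 * (1 + s) ^ 3 := by nlinarith
  calc (5 / 2 : ℝ) * ((2 * s * w + w ^ 2) * (2 * s ^ 2 + 2 * s * w + w ^ 2))
      ≤ (5 / 2 : ℝ) * ((w * (2 * s + 1)) * (2 * s ^ 2 + 2 * s + 1)) :=
        mul_le_mul_of_nonneg_left (mul_le_mul h1 h2 (by positivity) (by positivity)) (by norm_num)
    _ = (5 / 2 : ℝ) * w * ((2 * s + 1) * (2 * s ^ 2 + 2 * s + 1)) := by ring
    _ ≤ (5 / 2 : ℝ) * w * (4 * (1 + s) ^ 3) := by gcongr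
    _ = 10 * (1 + s) ^ 3 * w := by ring

/-- `|∂_p V(y)| ≤ 10 (1 + ‖y‖)³`. [folklore] -/
theorem abs_pderiv_luscherPotential_le (p : Fin 3 × Fin 3) (y : ZM) :
    |pderiv p luscherPotential y| ≤ 10 * (1 + ‖y‖) ^ 3 :=
  (abs_pderiv_le_norm_fderiv _ p y).trans (norm_fderiv_luscherPotential_le y)

end Potential

/-! ### §2. Polynomial × exponential domination -/

/-- A continuous function with `|g| ≤ A (1+‖x‖)^k e^{−‖x‖}` is integrable on `ℝ⁹`
(`(1+s)^{k+10} ≤ (k+10)! e^{1+s}`, and `(1+‖x‖)^{−10} ∈ L¹`). [folklore] -/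
theorem integrable_of_le_pow_mul_exp {g : ZM → ℝ} (hg : Continuous g) {A : ℝ} (k : ℕ)
    (h : ∀ x, |g x| ≤ A * ((1 + ‖x‖) ^ k * Real.exp (-‖x‖))) : Integrable g := by
  have hA : 0 ≤ A := by
    have := (abs_nonneg _).trans (h 0)
    rw [norm_zero, add_zero, one_pow, neg_zero, Real.exp_zero, mul_one, mul_one] at this; exact this
  have hdim : (Module.finrank ℝ ZM : ℝ) < 10 := by rw [finrank_ZM]; norm_num
  have hI : Integrable (fun x : ZM => (A * (Real.exp 1 * (Nat.factorial (k + 10) : ℝ))) * (1 + ‖x‖) ^ (-(10 : ℝ))) :=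
    (integrable_one_add_norm hdim).const_mul _
  refine hI.mono' hg.aestronglyMeasurable (Eventually.of_forall fun x => ?_)
  rw [Real.norm_eq_abs]
  refine (h x).trans ?_
  have hpos : 0 < 1 + ‖x‖ := by positivity
  -- `(1+s)^{k+10} ≤ (k+10)! e^{1+s}`
  have h1 : (1 + ‖x‖) ^ (k + 10) / (Nat.factorial (k + 10) : ℝ) ≤ Real.exp (1 + ‖x‖) :=
    Real.pow_div_factorial_le_exp _ hpos.le (k + 10)
  have hfac : (0 : ℝ) < Nat.factorial (k + 10) := by exact_mod_cast Nat.factorial_pos _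
  rw [div_le_iff₀ hfac, Real.exp_add] at h1
  have e : (1 + ‖x‖) ^ (-(10 : ℝ)) = ((1 + ‖x‖) ^ 10)⁻¹ := by
    rw [Real.rpow_neg hpos.le, show (10 : ℝ) = ((10 : ℕ) : ℝ) by norm_num, Real.rpow_natCast]
  rw [e]
  have hP : 0 < (1 + ‖x‖) ^ 10 := pow_pos hpos 10
  have hek : (1 + ‖x‖) ^ k * Real.exp (-‖x‖) * (1 + ‖x‖) ^ 10 ≤ Real.exp 1 * (Nat.factorial (k + 10) : ℝ) := by
    have e1 : (1 + ‖x‖) ^ k * Real.exp (-‖x‖) * (1 + ‖x‖) ^ 10 = (1 + ‖x‖) ^ (k + 10) * Real.exp (-‖x‖) := by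
      rw [pow_add]; ring
    rw [e1, Real.exp_neg, ← div_eq_mul_inv, div_le_iff₀ (Real.exp_pos _)]
    nlinarith [h1, Real.exp_pos ‖x‖, Real.exp_pos 1]
  have hek' : (1 + ‖x‖) ^ k * Real.exp (-‖x‖) ≤ Real.exp 1 * (Nat.factorial (k + 10) : ℝ) * ((1 + ‖x‖) ^ 10)⁻¹ :=
    (le_mul_inv_iff₀ hP).2 hek
  calc A * ((1 + ‖x‖) ^ k * Real.exp (-‖x‖)) ≤ A * (Real.exp 1 * (Nat.factorial (k + 10) : ℝ) * ((1 + ‖x‖) ^ 10)⁻¹) :=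
        mul_le_mul_of_nonneg_left hek' hA
    _ = A * (Real.exp 1 * (Nat.factorial (k + 10) : ℝ)) * ((1 + ‖x‖) ^ 10)⁻¹ := by ring

/-! ### §3. `h = H₀F` is `C¹` with polynomially-weighted exponential decay of `∇h` -/

section H0F

variable {m : ℕ} {f : Fin (m + 1) → ZM → ℝ} (hf : IsEigenFamily m f)
include hf

/-- `h = H₀F` as a function: `h = Σ c_j (E_j − V) f_j`. [folklore] -/
theorem eigSpanH0_eq_fun (c : Fin (m + 1) → ℝ) :
    eigSpanH0 f c = fun x => ∑ j, c j * ((physLevel ((j : ℕ) + 1) - luscherPotential x) * f j x) :=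
  funext (eigSpanH0_eq hf c)

/-- `h ∈ C¹`. [folklore] -/
theorem eigSpanH0_contDiff (c : Fin (m + 1) → ℝ) : ContDiff ℝ 1 (eigSpanH0 f c) := by
  rw [eigSpanH0_eq_fun hf c]
  exact ContDiff.sum fun j _ => contDiff_const.mul
    ((contDiff_const.sub (luscherPotential_contDiff (n := 1))).mul (hf.1 j 1))

/-- The partials of `h`: `∂_p h = Σ c_j (−∂_pV f_j + (E_j − V) ∂_p f_j)`. [folklore] -/
theorem pderiv_eigSpanH0 (c : Fin (m + 1) → ℝ) (p : Fin 3 × Fin 3) (x : ZM) :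
    pderiv p (eigSpanH0 f c) x = ∑ j, c j * (-(pderiv p luscherPotential x) * f j x +
      (physLevel ((j : ℕ) + 1) - luscherPotential x) * pderiv p (f j) x) := by
  have hVd : Differentiable ℝ luscherPotential := (luscherPotential_contDiff (n := 1)).differentiable one_ne_zero
  have hfd : ∀ j, Differentiable ℝ (f j) := fun j => differentiable_of_contDiff_two (hf.1 j 2)
  have hgd : ∀ j : Fin (m + 1), Differentiable ℝ (fun x => (physLevel ((j : ℕ) + 1) - luscherPotential x) * f j x) := fun j =>
    ((differentiable_const _).sub hVd).mul (hfd j)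
  rw [eigSpanH0_eq_fun hf c, pderiv_sum_mul hgd c p x]
  refine Finset.sum_congr rfl fun j _ => ?_
  congr 1
  -- product rule and `∂_p (E − V) = −∂_p V`
  have hd1 : Differentiable ℝ (fun x => physLevel ((j : ℕ) + 1) - luscherPotential x) := (differentiable_const _).sub hVd
  have hprod := pderiv_mul hd1 (hfd j) p x
  have e1 : (fun x => (physLevel ((j : ℕ) + 1) - luscherPotential x) * f j x) =
      ((fun x => physLevel ((j : ℕ) + 1) - luscherPotential x) * f j) := rfl
  rw [e1, hprod]
  have e2 : pderiv p (fun x => physLevel ((j : ℕ) + 1) - luscherPotential x) x = -pderiv p luscherPotential x := by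
    simp only [pderiv]
    rw [fderiv_const_sub]
    simp
  rw [e2]

/-- **Pointwise bound** `|∂_p h(x)| ≤ (Σ|c_j|) C (10(1+‖x‖)³ + E_m + ¼‖x‖⁴) e^{−‖x‖} ≤ (Σ|c_j|) C (11 + E) (1+‖x‖)⁴ e^{−‖x‖}`,
where `C` is a uniform `ExpDecay₂` constant and `E = physLevel (m+1)`. [folklore] -/
theorem abs_pderiv_eigSpanH0_le (c : Fin (m + 1) → ℝ) :
    ∃ A : ℝ, 0 ≤ A ∧ ∀ p x, |pderiv p (eigSpanH0 f c) x| ≤ A * (∑ j, |c j|) * ((1 + ‖x‖) ^ 4 * Real.exp (-‖x‖)) := by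
  obtain ⟨C, hC0, hC⟩ := exists_uniform_expDecay₂ hf.2.2.2.2
  set E := physLevel (m + 1) with hE
  have hE0 : 0 ≤ E := physLevel_nonneg (Nat.succ_le_succ (Nat.zero_le m))
  have hEj : ∀ j : Fin (m + 1), physLevel ((j : ℕ) + 1) ≤ E := fun j =>
    physLevel_mono (Nat.succ_le_succ (Nat.zero_le _)) (Nat.succ_le_succ (Nat.le_of_lt_succ j.2))
  have hEj0 : ∀ j : Fin (m + 1), 0 ≤ physLevel ((j : ℕ) + 1) := fun j => physLevel_nonneg (Nat.succ_le_succ (Nat.zero_le _))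
  refine ⟨C * (11 + E), by positivity, fun p x => ?_⟩
  rw [pderiv_eigSpanH0 hf c p x]
  have hV := abs_pderiv_luscherPotential_le p x
  have hV0 := luscherPotential_nonneg x
  have hV4 := luscherPotential_le_norm_pow_four x
  have hn := norm_nonneg x
  -- each summand
  have hterm : ∀ j, |-(pderiv p luscherPotential x) * f j x + (physLevel ((j : ℕ) + 1) - luscherPotential x) * pderiv p (f j) x|
      ≤ C * (11 + E) * ((1 + ‖x‖) ^ 4 * Real.exp (-‖x‖)) := by
    intro j
    refine (abs_add_le _ _).trans ?_
    rw [abs_mul, abs_mul, abs_neg]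
    have h1 : |pderiv p luscherPotential x| * |f j x| ≤ 10 * (1 + ‖x‖) ^ 3 * (C * Real.exp (-‖x‖)) :=
      mul_le_mul hV (hC j x).1 (abs_nonneg _) (by positivity)
    have h2 : |physLevel ((j : ℕ) + 1) - luscherPotential x| ≤ E + (1 / 4 : ℝ) * ‖x‖ ^ 4 := by
      rw [abs_le]; constructor <;> nlinarith [hEj j, hEj0 j]
    have h3 : |physLevel ((j : ℕ) + 1) - luscherPotential x| * |pderiv p (f j) x| ≤
        (E + (1 / 4 : ℝ) * ‖x‖ ^ 4) * (C * Real.exp (-‖x‖)) :=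
      mul_le_mul h2 ((hC j x).2.1 p) (abs_nonneg _) (by positivity)
    have he := Real.exp_pos (-‖x‖)
    have hpoly : 10 * (1 + ‖x‖) ^ 3 + (E + (1 / 4 : ℝ) * ‖x‖ ^ 4) ≤ (11 + E) * (1 + ‖x‖) ^ 4 := by
      nlinarith [pow_le_pow_left₀ hn (by linarith : ‖x‖ ≤ 1 + ‖x‖) 4, one_le_pow₀ (n := 3) (by linarith : (1:ℝ) ≤ 1 + ‖x‖),
        one_le_pow₀ (n := 4) (by linarith : (1:ℝ) ≤ 1 + ‖x‖), pow_nonneg (by linarith : (0:ℝ) ≤ 1 + ‖x‖) 3]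
    calc |pderiv p luscherPotential x| * |f j x| + |physLevel ((j : ℕ) + 1) - luscherPotential x| * |pderiv p (f j) x|
        ≤ 10 * (1 + ‖x‖) ^ 3 * (C * Real.exp (-‖x‖)) + (E + (1 / 4 : ℝ) * ‖x‖ ^ 4) * (C * Real.exp (-‖x‖)) := add_le_add h1 h3
      _ = (10 * (1 + ‖x‖) ^ 3 + (E + (1 / 4 : ℝ) * ‖x‖ ^ 4)) * (C * Real.exp (-‖x‖)) := by ring
      _ ≤ ((11 + E) * (1 + ‖x‖) ^ 4) * (C * Real.exp (-‖x‖)) := mul_le_mul_of_nonneg_right hpoly (by positivity)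
      _ = C * (11 + E) * ((1 + ‖x‖) ^ 4 * Real.exp (-‖x‖)) := by ring
  calc |∑ j, c j * (-(pderiv p luscherPotential x) * f j x + (physLevel ((j : ℕ) + 1) - luscherPotential x) * pderiv p (f j) x)|
      ≤ ∑ j, |c j| * (C * (11 + E) * ((1 + ‖x‖) ^ 4 * Real.exp (-‖x‖))) := by
        refine (Finset.abs_sum_le_sum_abs _ _).trans (Finset.sum_le_sum fun j _ => ?_)
        rw [abs_mul]; exact mul_le_mul_of_nonneg_left (hterm j) (abs_nonneg _)
    _ = C * (11 + E) * (∑ j, |c j|) * ((1 + ‖x‖) ^ 4 * Real.exp (-‖x‖)) := by rw [← Finset.sum_mul]; ring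

/-- **Integrability package of `h = H₀F`**: `∂_p h ∈ L¹`, `(∂_p h)² ∈ L¹`, `‖Dh‖ ∈ L¹`. [folklore] -/
theorem eigSpanH0_deriv_integrable (c : Fin (m + 1) → ℝ) :
    (∀ p, Integrable (pderiv p (eigSpanH0 f c))) ∧ (∀ p, Integrable fun x => pderiv p (eigSpanH0 f c) x ^ 2) ∧
      Integrable (fun x => ‖fderiv ℝ (eigSpanH0 f c) x‖) := by
  obtain ⟨A, hA0, hA⟩ := abs_pderiv_eigSpanH0_le hf c
  have h1 : ContDiff ℝ 1 (eigSpanH0 f c) := eigSpanH0_contDiff hf c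
  have hc : ∀ p, Continuous (pderiv p (eigSpanH0 f c)) := fun p =>
    (h1.continuous_fderiv one_ne_zero).clm_apply continuous_const
  set S := ∑ j, |c j| with hS
  have hS0 : 0 ≤ S := Finset.sum_nonneg fun j _ => abs_nonneg _
  refine ⟨fun p => integrable_of_le_pow_mul_exp (hc p) 4 (A := A * S) (fun x => hA p x), fun p => ?_, ?_⟩
  · -- square: `(A S)² (1+s)^8 e^{-2s} ≤ (A S)² (1+s)^8 e^{-s}`
    refine integrable_of_le_pow_mul_exp ((hc p).fun_pow 2) 8 (A := (A * S) ^ 2) (fun x => ?_)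
    rw [abs_of_nonneg (sq_nonneg _)]
    have h := hA p x
    have hsq : pderiv p (eigSpanH0 f c) x ^ 2 ≤ (A * S * ((1 + ‖x‖) ^ 4 * Real.exp (-‖x‖))) ^ 2 := by
      rw [← sq_abs]; exact pow_le_pow_left₀ (abs_nonneg _) h 2
    have he : Real.exp (-‖x‖) ≤ 1 := Real.exp_le_one_iff.mpr (neg_nonpos.mpr (norm_nonneg x))
    have he0 := Real.exp_pos (-‖x‖)
    have hp8 : 0 ≤ (1 + ‖x‖) ^ 8 := by positivity
    calc pderiv p (eigSpanH0 f c) x ^ 2 ≤ (A * S * ((1 + ‖x‖) ^ 4 * Real.exp (-‖x‖))) ^ 2 := hsq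
      _ = (A * S) ^ 2 * ((1 + ‖x‖) ^ 8 * Real.exp (-‖x‖)) * Real.exp (-‖x‖) := by ring
      _ ≤ (A * S) ^ 2 * ((1 + ‖x‖) ^ 8 * Real.exp (-‖x‖)) * 1 := by gcongr
      _ = (A * S) ^ 2 * ((1 + ‖x‖) ^ 8 * Real.exp (-‖x‖)) := mul_one _
  · refine integrable_of_le_pow_mul_exp (h1.continuous_fderiv one_ne_zero).norm 4 (A := 3 * (A * S)) (fun x => ?_)
    rw [abs_of_nonneg (norm_nonneg _)]
    have h := norm_fderiv_le_of_pderiv_le (B := A * S * ((1 + ‖x‖) ^ 4 * Real.exp (-‖x‖))) (by positivity)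
      (fun p => (hA p x).trans (le_of_eq (by ring)))
    linarith

/-- `Σ_p ∫ (∂_p h)² ≤ K' · Σ c_j²` with `K'` depending only on the family (Cauchy–Schwarz in `j`). [folklore] -/
theorem sum_integral_pderiv_eigSpanH0_sq_le :
    ∃ K' : ℝ, 0 ≤ K' ∧ ∀ c : Fin (m + 1) → ℝ, ∑ p, ∫ x, pderiv p (eigSpanH0 f c) x ^ 2 ≤ K' * ∑ j, c j ^ 2 := by
  -- the per-family building blocks `w_{jp} = −∂_pV f_j + (E_j − V) ∂_p f_j`
  set w : Fin (m + 1) → Fin 3 × Fin 3 → ZM → ℝ := fun j p x =>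
    -(pderiv p luscherPotential x) * f j x + (physLevel ((j : ℕ) + 1) - luscherPotential x) * pderiv p (f j) x with hw
  -- each `w_{jp}² ∈ L¹`: it is `(∂_p h)²` for the coefficient vector `e_j`
  have hwint : ∀ j p, Integrable fun x => w j p x ^ 2 := by
    intro j p
    have h := (eigSpanH0_deriv_integrable hf (fun i => if i = j then 1 else 0)).2.1 p
    refine h.congr (Eventually.of_forall fun x => ?_)
    show pderiv p (eigSpanH0 f fun i => if i = j then 1 else 0) x ^ 2 = w j p x ^ 2
    rw [pderiv_eigSpanH0 hf _ p x]
    congr 1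
    rw [Finset.sum_eq_single j (fun i _ hij => by rw [if_neg hij, zero_mul]) (fun h => (h (Finset.mem_univ j)).elim)]
    rw [if_pos rfl, one_mul]
  refine ⟨∑ p, ∑ j, ∫ x, w j p x ^ 2, Finset.sum_nonneg fun p _ => Finset.sum_nonneg fun j _ =>
    integral_nonneg fun x => sq_nonneg _, fun c => ?_⟩
  rw [Finset.sum_mul]
  refine Finset.sum_le_sum fun p _ => ?_
  have hpt : ∀ x, pderiv p (eigSpanH0 f c) x ^ 2 ≤ (∑ j, c j ^ 2) * ∑ j, w j p x ^ 2 := fun x => by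
    rw [pderiv_eigSpanH0 hf c p x]
    exact Finset.sum_mul_sq_le_sq_mul_sq Finset.univ c (fun j => w j p x)
  have hdom : Integrable fun x => (∑ j, c j ^ 2) * ∑ j, w j p x ^ 2 :=
    (integrable_finsetSum _ fun j _ => hwint j p).const_mul _
  calc ∫ x, pderiv p (eigSpanH0 f c) x ^ 2 ≤ ∫ x, (∑ j, c j ^ 2) * ∑ j, w j p x ^ 2 :=
        integral_mono ((eigSpanH0_deriv_integrable hf c).2.1 p) hdom hpt
    _ = (∑ j, c j ^ 2) * ∑ j, ∫ x, w j p x ^ 2 := by rw [integral_const_mul, integral_finsetSum _ fun j _ => hwint j p]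
    _ = (∑ j, ∫ x, w j p x ^ 2) * ∑ j, c j ^ 2 := mul_comm _ _

end H0F

end Summit.QuantumFields.YangMills.Theorems.FemtoTransferGap

end
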